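import Summits.Ventures.PercRepro.RankLevelSetLevelFiveCqTwenty
import Summits.Ventures.PercRepro.S2CoreEighteenSeven
import Summits.Ventures.PercRepro.S2CoreEighteen
import Summits.Ventures.PercRepro.S2SharpCoreXMidCTQ
import Summits.Ventures.PercRepro.S2CobasisCoreSixT
import Summits.Ventures.PercRepro.S2CellsP18B
import Summits.Ventures.PercRepro.S2CellsP18X
import Summits.Ventures.PercRepro.S2CellsP18XB

/-!
# PercRepro — THEOREM C₅ AT `19`: C-025 AT LEVEL `5` FOR EVERY `p ≥ 19` (p7, gen 7; sub-claim S2; the «19» assembly)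

The `p = 18` row of the cell map, closed by FOUR levers on top of the «20» kit: p4's QUART multiplicity in the set-indexed
level counts (S2SetCountQuart / S2SetCountQuartMid → the cores S2SharpTopXQICTQ5 / S2SharpCoreXQICTQ5 / S2SharpCoreXMidCTQ) at
`d = 8, 9, 10, 11, 12, 14`; p2's `5`-circuit chain `s₅ ≤ avgChain5b d` (S1FiveCircuitBase) on every new core; the cell `(18, 7)`
by the coloop split (S2CoreEighteenSeven: the coloop-free case on the `m = 25` cap `s₄ ≤ 63`, the coloop case by one deletion
onto the scaled cell `(17, 7)` at `Φ(18, 5)/2`); the cobasis core with parameters at `d = 6` (S2CobasisCoreSixT); the landed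
XQICT core with p3's table at `d = 13, 15 … 29`; and the corank-`≥ 30` regime by the sizes `6 … 17` (S2CoreEighteen, from `n₀ = 48`
— the corank `29` is a cell). Every cell `(18, d)`, `6 ≤ d ≤ 29`, reads `≤ 0.987` (`(18, 7)`: `0.987` / `0.929`; `(18, 13)`: `0.977`;
`(18, 29)`: `0.965`). Declarations:
* `S2.cellsP18X` — the 16 landed-core cells dispatched (`cq3 d` / `avgChain d` by `decide +kernel`);
* `c025_core_five_eighteen_six / _eight / _ten`, `c025_core_five_eighteen_q9 / _q11 / _q12 / _q14` — the cells with a lever;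
* **`c025_core_five_eighteen_xx`** — the `e`-free core at level `5`, rank `18`, every corank `6 ≤ d ≤ 29`;
* **`c025_five_of_four_cq_xix_from`** — for `P ≥ 18`, level `4` for all `p ≥ P` implies level `5` for all `p ≥ P + 1`;
* **`c025_five_large_sharp19`** — UNCONDITIONAL over the landed tree: C-025 at level `5` for every `p ≥ 19` (level `4` from
  S1's `c025_four_seventeen`); `c025_five_large_sharp19'` is the `C025` spelling.
Axioms: standard. -/

open scoped Matroid

namespace PercRepro

namespace S2

/-- **The `p = 18` cells on the landed XQICT core, dispatched**: for every corank `13 ≤ d ≤ 29`, `d ≠ 14`, some slack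
`m ≤ 1024` with `1024·U″(18, d) ≤ (1024 − m)·2^(d−5)·C(23, 5)` and `1024·T″(18 + d, d) ≤ m·2^(18+d)`, at `s3b = cq3 d` and
`s4b = avgChain d`. -/
theorem cellsP18X (d : ℕ) (hd13 : 13 ≤ d) (hd29 : d ≤ 29) (hn14 : d ≠ 14) :
    ∃ m : ℕ, m ≤ 1024 ∧
      (1024 * ((((18 + d).choose 5 : ℚ) - (TriangleCap.cq3 d : ℚ) * ((18 + d - 3).choose 2 : ℚ) +
        (((TriangleCap.cq3 d).choose 2 : ℕ) : ℚ)) +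
      (∑ j ∈ Finset.range (d - 5), (Nat.choose (min 13 ((d + 6) / 2 + 1 - 2)) j : ℚ) / (((j + 1) + 3 * (j + 1).choose 2 : ℕ) : ℚ)) *
        ((TriangleCap.cq3 d * (18 + d - 3).choose 3 + S1.avgChain d * (18 + d - 4).choose 2 + (d + 4).choose 5 * (18 + d - 5) + (d + 5).choose 6 : ℕ) : ℚ) +
      ((∑ j ∈ Finset.range (d - 5), (Nat.choose (min 19 (5 + d) - 6) j : ℚ) / (((j + 1) + 3 * (j + 1).choose 2 : ℕ) : ℚ)) -
        (∑ j ∈ Finset.range (d - 5), (Nat.choose (min 13 ((d + 6) / 2 + 1 - 2)) j : ℚ) / (((j + 1) + 3 * (j + 1).choose 2 : ℕ) : ℚ))) *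
        ((min 19 (5 + d)).choose 6 : ℚ)) ≤
        ((1024 - m : ℕ) : ℚ) * 2 ^ (d - 5) * ((18 + 5).choose 5 : ℚ)) ∧
      (1024 * ((((18 + d).choose 4 : ℚ) +
      (∑ j ∈ Finset.range 6, (Nat.choose (min 5 ((d + 3) / 2 + 1 - 2)) j : ℚ) / (((j + 1) + 3 * (j + 1).choose 2 : ℕ) : ℚ)) *
        ((TriangleCap.cq3 d * (18 + d - 3).choose 2 + S1.avgChain d * (18 + d - 4) + (d + 4).choose 5 : ℕ) : ℚ) +
      ((∑ j ∈ Finset.range 6, (Nat.choose 5 j : ℚ) / (((j + 1) + 3 * (j + 1).choose 2 : ℕ) : ℚ)) -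
        (∑ j ∈ Finset.range 6, (Nat.choose (min 5 ((d + 3) / 2 + 1 - 2)) j : ℚ) / (((j + 1) + 3 * (j + 1).choose 2 : ℕ) : ℚ))) *
        ((10 : ℕ).choose 5 : ℚ)) +
      (((18 + d).choose 3 * 2 ^ 3 + (18 + d).choose 2 * 2 + (18 + d) + 1 : ℕ) : ℚ) +
      (((18 + d).choose 5 : ℚ) + (∑ j ∈ Finset.range (d), (Nat.choose (min 13 ((d + 6) / 2 + 1 - 2)) j : ℚ) / (((j + 1) + 3 * (j + 1).choose 2 : ℕ) : ℚ)) * ((TriangleCap.cq3 d * (18 + d - 3).choose 3 + S1.avgChain d * (18 + d - 4).choose 2 + (d + 4).choose 5 * (18 + d - 5) + (d + 5).choose 6 : ℕ) : ℚ) +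
        ((∑ j ∈ Finset.range (d), (Nat.choose (min 19 (5 + d) - 6) j : ℚ) / (((j + 1) + 3 * (j + 1).choose 2 : ℕ) : ℚ)) - (∑ j ∈ Finset.range (d), (Nat.choose (min 13 ((d + 6) / 2 + 1 - 2)) j : ℚ) / (((j + 1) + 3 * (j + 1).choose 2 : ℕ) : ℚ))) *
        ((min 19 (5 + d)).choose 6 : ℚ)) +
      ((∑ j ∈ Finset.range (d + 1), (18 + d).choose j : ℕ) : ℚ)) ≤ (m : ℚ) * 2 ^ (18 + d)) := by
  interval_cases d
  · rw [show TriangleCap.cq3 13 = 34 by decide +kernel, show S1.avgChain 13 = 483 by decide +kernel]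
    exact ⟨246, by norm_num, cellP18X_13_poly, cellP18X_13_tail⟩
  · exact absurd rfl hn14
  · rw [show TriangleCap.cq3 15 = 47 by decide +kernel, show S1.avgChain 15 = 763 by decide +kernel]
    exact ⟨376, by norm_num, cellP18X_15_poly, cellP18X_15_tail⟩
  · rw [show TriangleCap.cq3 16 = 54 by decide +kernel, show S1.avgChain 16 = 942 by decide +kernel]
    exact ⟨445, by norm_num, cellP18X_16_poly, cellP18X_16_tail⟩
  · rw [show TriangleCap.cq3 17 = 62 by decide +kernel, show S1.avgChain 17 = 1151 by decide +kernel]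
    exact ⟨514, by norm_num, cellP18X_17_poly, cellP18X_17_tail⟩
  · rw [show TriangleCap.cq3 18 = 71 by decide +kernel, show S1.avgChain 18 = 1393 by decide +kernel]
    exact ⟨582, by norm_num, cellP18X_18_poly, cellP18X_18_tail⟩
  · rw [show TriangleCap.cq3 19 = 81 by decide +kernel, show S1.avgChain 19 = 1671 by decide +kernel]
    exact ⟨645, by norm_num, cellP18X_19_poly, cellP18X_19_tail⟩
  · rw [show TriangleCap.cq3 20 = 92 by decide +kernel, show S1.avgChain 20 = 1989 by decide +kernel]
    exact ⟨704, by norm_num, cellP18X_20_poly, cellP18X_20_tail⟩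
  · rw [show TriangleCap.cq3 21 = 104 by decide +kernel, show S1.avgChain 21 = 2350 by decide +kernel]
    exact ⟨758, by norm_num, cellP18X_21_poly, cellP18X_21_tail⟩
  · rw [show TriangleCap.cq3 22 = 117 by decide +kernel, show S1.avgChain 22 = 2758 by decide +kernel]
    exact ⟨805, by norm_num, cellP18X_22_poly, cellP18X_22_tail⟩
  · rw [show TriangleCap.cq3 23 = 131 by decide +kernel, show S1.avgChain 23 = 3217 by decide +kernel]
    exact ⟨846, by norm_num, cellP18X_23_poly, cellP18X_23_tail⟩
  · rw [show TriangleCap.cq3 24 = 146 by decide +kernel, show S1.avgChain 24 = 3731 by decide +kernel]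
    exact ⟨881, by norm_num, cellP18X_24_poly, cellP18X_24_tail⟩
  · rw [show TriangleCap.cq3 25 = 162 by decide +kernel, show S1.avgChain 25 = 4305 by decide +kernel]
    exact ⟨911, by norm_num, cellP18X_25_poly, cellP18X_25_tail⟩
  · rw [show TriangleCap.cq3 26 = 179 by decide +kernel, show S1.avgChain 26 = 4942 by decide +kernel]
    exact ⟨935, by norm_num, cellP18X_26_poly, cellP18X_26_tail⟩
  · rw [show TriangleCap.cq3 27 = 197 by decide +kernel, show S1.avgChain 27 = 5648 by decide +kernel]
    exact ⟨955, by norm_num, cellP18X_27_poly, cellP18X_27_tail⟩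
  · rw [show TriangleCap.cq3 28 = 216 by decide +kernel, show S1.avgChain 28 = 6427 by decide +kernel]
    exact ⟨971, by norm_num, cellP18X_28_poly, cellP18X_28_tail⟩
  · rw [show TriangleCap.cq3 29 = 236 by decide +kernel, show S1.avgChain 29 = 7283 by decide +kernel]
    exact ⟨984, by norm_num, cellP18X_29_poly, cellP18X_29_tail⟩

end S2

namespace ThmN

open Set

variable {α : Type}

/-- **The `e`-free core at level `5`, rank `18`, corank `6`**: the cobasis core with `s₃ ≤ 10` (cq3 6), `s₄ ≤ 53`
(p2, nullity `6`), `s₅ ≤ 234` (p2's `avgChain5b 6`); slack `23/1024`. -/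
theorem c025_core_five_eighteen_six (M : Matroid α) [M.Finite]
    (hR : M.eRank = ((18 : ℕ) : ℕ∞)) (hn : M.E.ncard = 18 + 6)
    (hfree : ∀ e ∈ M.E, ∃ A ⊆ M.E \ {e}, e ∉ M.closure A ∧ e ∉ M.closure ((M.E \ {e}) \ A)) :
    RLS M 18 5 := by
  have hd : M.E.encard = M.eRank + ((6 : ℕ) : ℕ∞) := by
    rw [hR, ← M.ground_finite.cast_ncard_eq, hn]
    push_cast
    ring
  have hs3 := TriangleCap.core_ncard_triangles_le_cq3 M hfree hd
  rw [show TriangleCap.cq3 6 = 10 by decide +kernel] at hs3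
  have hs4 := S1.ncard_fourCircuits_le_fifty_three_uncond M hfree (by exact_mod_cast hd)
  have hs5 := S1.ncard_fiveCircuits_le_two_thirty_four M hfree (by exact_mod_cast hd)
  exact c025_core_five_cobasis_six_cell_t M 18 (by norm_num) hR hn hfree 10 53 234 hs3 hs4 hs5
    ⟨23, by norm_num, S2.cellP18C6_poly, S2.cellP18C6_tail⟩

/-- **The `e`-free core at level `5`, rank `18`, corank `8`**: the quart XMid core, `N_mid = 7·C(12, 6)` (S2MidFlatsSeven),
`s₃ ≤ 13`, `s₄ ≤ 114`, `s₅ ≤ 651`; slack `58/1024`. -/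
theorem c025_core_five_eighteen_eight (M : Matroid α) [M.Finite]
    (hR : M.eRank = ((18 : ℕ) : ℕ∞)) (hn : M.E.ncard = 18 + 8)
    (hfree : ∀ e ∈ M.E, ∃ A ⊆ M.E \ {e}, e ∉ M.closure A ∧ e ∉ M.closure ((M.E \ {e}) \ A)) :
    RLS M 18 5 := by
  have hL0 : ∀ e ∈ M.E, ¬ M.IsLoop e := not_isLoop_of_free M hfree
  have hd : M.E.encard = M.eRank + 8 := by
    rw [hR, ← M.ground_finite.cast_ncard_eq, hn]
    push_cast
    ring
  have hflat' : ∀ X ⊆ M.E, M.eRk X ≤ ((5 - 1 : ℕ) : ℕ∞) → X.ncard ≤ 10 := fun X hX hr =>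
    ncard_le_ten_of_eRk_le_four_of_free M hfree hX (by simpa using hr)
  have hC2 : ∀ P ⊆ M.E, M.eRk P ≤ 3 → P.ncard ≤ 6 :=
    fun P hP hr => ncard_le_six_of_eRk_le_three_of_free M hfree hP hr
  have hC0 : ∀ X ⊆ M.E, M.eRk X ≤ 1 → X.ncard ≤ 1 := fun X hX hr => by
    have := ncard_add_one_le_two_pow_of_eRk_le M hL0 hfree 1 X hX hr
    omega
  have hmid := S2.card_spanMid_le_seven hflat' hC2 hC0 hd
  have hmid' : (S2.spanMid M 5 (min 10 (4 + 8)) ((8 + 6) / 2 + 1)).card ≤ 7 * (12).choose 6 := by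
    rw [show min 10 (4 + 8) = 10 by norm_num, show (8 + 6) / 2 + 1 = 8 by norm_num]
    exact hmid
  have hs3 := TriangleCap.core_ncard_triangles_le_cq3 M hfree hd
  rw [show TriangleCap.cq3 8 = 13 by decide +kernel] at hs3
  have hs4 := S1.ncard_fourCircuits_le_avgChain 8 M hfree hd
  rw [S1.avgChain_values.2.1] at hs4
  have hs5 := S1.ncard_fiveCircuits_le_avgChain5b 8 M hfree hd
  rw [S1.avgChain5b_values.2.1] at hs5
  have key := c025_core_five_sharp_cell_xmidctq M 18 8 (7 * (12).choose 6) (by norm_num) hR hn hfree 13 114 651 hs3 hs4 hs5 hmid'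
  exact key ⟨58, by norm_num, S2.cellP18XM8_poly, S2.cellP18XM8_tail⟩

/-- **The `e`-free core at level `5`, rank `18`, corank `10`**: the quart XMid core, `N_mid = 136092` (S2MidFlatsTenC,
`|E| = 28 ≤ 31`), `s₃ ≤ 20`, `s₄ ≤ 216`, `s₅ ≤ 1518`; slack `104/1024`. -/
theorem c025_core_five_eighteen_ten (M : Matroid α) [M.Finite]
    (hR : M.eRank = ((18 : ℕ) : ℕ∞)) (hn : M.E.ncard = 18 + 10)
    (hfree : ∀ e ∈ M.E, ∃ A ⊆ M.E \ {e}, e ∉ M.closure A ∧ e ∉ M.closure ((M.E \ {e}) \ A)) :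
    RLS M 18 5 := by
  have hL0 : ∀ e ∈ M.E, ¬ M.IsLoop e := not_isLoop_of_free M hfree
  have hd : M.E.encard = M.eRank + 10 := by
    rw [hR, ← M.ground_finite.cast_ncard_eq, hn]
    push_cast
    ring
  have hs : ∀ e ∈ M.E, ∀ f ∈ M.E, e ≠ f → M.eRk {e, f} = 2 := by
    intro e he f hf hef
    have h2 : (2 : ℕ∞) ≤ M.eRk {e, f} :=
      two_le_eRk_of_two_le_ncard_of_free M hfree (pair_subset he hf) (by rw [ncard_pair hef])
    have h3 : M.eRk {e, f} ≤ 2 := by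
      have := M.eRk_le_encard {e, f}
      rwa [encard_pair hef] at this
    exact le_antisymm h3 h2
  have hC1 : ∀ L ⊆ M.E, M.eRk L = 2 → L.ncard ≤ 3 :=
    fun L hL hr => ncard_le_three_of_eRk_two M hs hfree hL hr
  have hflat' : ∀ X ⊆ M.E, M.eRk X ≤ ((5 - 1 : ℕ) : ℕ∞) → X.ncard ≤ 10 := fun X hX hr =>
    ncard_le_ten_of_eRk_le_four_of_free M hfree hX (by simpa using hr)
  have hC2 : ∀ P ⊆ M.E, M.eRk P ≤ 3 → P.ncard ≤ 6 :=
    fun P hP hr => ncard_le_six_of_eRk_le_three_of_free M hfree hP hr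
  have hC0 : ∀ X ⊆ M.E, M.eRk X ≤ 1 → X.ncard ≤ 1 := fun X hX hr => by
    have := ncard_add_one_le_two_pow_of_eRk_le M hL0 hfree 1 X hX hr
    omega
  have hmid := S2.card_spanMid_le_ten_le hC1 hflat' hC2 hC0 hd (by omega)
  have hmid' : (S2.spanMid M 5 (min 10 (4 + 10)) ((10 + 6) / 2 + 1)).card ≤ 136092 := by
    rw [show min 10 (4 + 10) = 10 by norm_num, show (10 + 6) / 2 + 1 = 9 by norm_num]
    exact hmid
  have hs3 := TriangleCap.core_ncard_triangles_le_cq3 M hfree hd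
  rw [show TriangleCap.cq3 10 = 20 by decide +kernel] at hs3
  have hs4 := S1.ncard_fourCircuits_le_avgChain 10 M hfree hd
  rw [S1.avgChain_values.2.2.2.1] at hs4
  have hs5 := S1.ncard_fiveCircuits_le_avgChain5b 10 M hfree hd
  rw [S1.avgChain5b_values.2.2.2] at hs5
  have key := c025_core_five_sharp_cell_xmidctq M 18 10 136092 (by norm_num) hR hn hfree 20 216 1518 hs3 hs4 hs5 hmid'
  exact key ⟨104, by norm_num, S2.cellP18XM10_poly, S2.cellP18XM10_tail⟩

/-- **The `e`-free core at level `5`, rank `18`, corank `9`**: the quart XQICT core with `s₃ ≤ 16` (cq3), `s₄ ≤ 159`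
(avgChain), `s₅ ≤ 1012` (avgChain5b); slack `67/1024`. -/
theorem c025_core_five_eighteen_q9 (M : Matroid α) [M.Finite]
    (hR : M.eRank = ((18 : ℕ) : ℕ∞)) (hn : M.E.ncard = 18 + 9)
    (hfree : ∀ e ∈ M.E, ∃ A ⊆ M.E \ {e}, e ∉ M.closure A ∧ e ∉ M.closure ((M.E \ {e}) \ A)) :
    RLS M 18 5 := by
  have hd : M.E.encard = M.eRank + ((9 : ℕ) : ℕ∞) := by
    rw [hR, ← M.ground_finite.cast_ncard_eq, hn]
    push_cast
    ring
  have hs3 := TriangleCap.core_ncard_triangles_le_cq3 M hfree hd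
  rw [show TriangleCap.cq3 9 = 16 by decide +kernel] at hs3
  have hs4 := S1.ncard_fourCircuits_le_avgChain 9 M hfree hd
  rw [show S1.avgChain 9 = 159 by decide +kernel] at hs4
  have hs5 := S1.ncard_fiveCircuits_le_avgChain5b 9 M hfree hd
  rw [show S1.avgChain5b 9 = 1012 by decide +kernel] at hs5
  exact c025_core_five_sharp_cell_xqictq5 M 18 9 (by norm_num) (by norm_num) hR hn hfree 16 159 1012 hs3 hs4 hs5
    ⟨67, by norm_num, S2.cellP18Q_9_poly, S2.cellP18Q_9_tail⟩

/-- **The `e`-free core at level `5`, rank `18`, corank `11`**: the quart XQICT core with `s₃ ≤ 24` (cq3), `s₄ ≤ 288`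
(avgChain), `s₅ ≤ 2208` (avgChain5b); slack `139/1024`. -/
theorem c025_core_five_eighteen_q11 (M : Matroid α) [M.Finite]
    (hR : M.eRank = ((18 : ℕ) : ℕ∞)) (hn : M.E.ncard = 18 + 11)
    (hfree : ∀ e ∈ M.E, ∃ A ⊆ M.E \ {e}, e ∉ M.closure A ∧ e ∉ M.closure ((M.E \ {e}) \ A)) :
    RLS M 18 5 := by
  have hd : M.E.encard = M.eRank + ((11 : ℕ) : ℕ∞) := by
    rw [hR, ← M.ground_finite.cast_ncard_eq, hn]
    push_cast
    ring
  have hs3 := TriangleCap.core_ncard_triangles_le_cq3 M hfree hd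
  rw [show TriangleCap.cq3 11 = 24 by decide +kernel] at hs3
  have hs4 := S1.ncard_fourCircuits_le_avgChain 11 M hfree hd
  rw [show S1.avgChain 11 = 288 by decide +kernel] at hs4
  have hs5 := S1.ncard_fiveCircuits_le_avgChain5b 11 M hfree hd
  rw [show S1.avgChain5b 11 = 2208 by decide +kernel] at hs5
  exact c025_core_five_sharp_cell_xqictq5 M 18 11 (by norm_num) (by norm_num) hR hn hfree 24 288 2208 hs3 hs4 hs5
    ⟨139, by norm_num, S2.cellP18Q_11_poly, S2.cellP18Q_11_tail⟩

/-- **The `e`-free core at level `5`, rank `18`, corank `12`**: the quart XQICT core with `s₃ ≤ 29` (cq3), `s₄ ≤ 376`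
(avgChain), `s₅ ≤ 3128` (avgChain5b); slack `188/1024`. -/
theorem c025_core_five_eighteen_q12 (M : Matroid α) [M.Finite]
    (hR : M.eRank = ((18 : ℕ) : ℕ∞)) (hn : M.E.ncard = 18 + 12)
    (hfree : ∀ e ∈ M.E, ∃ A ⊆ M.E \ {e}, e ∉ M.closure A ∧ e ∉ M.closure ((M.E \ {e}) \ A)) :
    RLS M 18 5 := by
  have hd : M.E.encard = M.eRank + ((12 : ℕ) : ℕ∞) := by
    rw [hR, ← M.ground_finite.cast_ncard_eq, hn]
    push_cast
    ring
  have hs3 := TriangleCap.core_ncard_triangles_le_cq3 M hfree hd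
  rw [show TriangleCap.cq3 12 = 29 by decide +kernel] at hs3
  have hs4 := S1.ncard_fourCircuits_le_avgChain 12 M hfree hd
  rw [show S1.avgChain 12 = 376 by decide +kernel] at hs4
  have hs5 := S1.ncard_fiveCircuits_le_avgChain5b 12 M hfree hd
  rw [show S1.avgChain5b 12 = 3128 by decide +kernel] at hs5
  exact c025_core_five_sharp_cell_xqictq5 M 18 12 (by norm_num) (by norm_num) hR hn hfree 29 376 3128 hs3 hs4 hs5
    ⟨188, by norm_num, S2.cellP18Q_12_poly, S2.cellP18Q_12_tail⟩

/-- **The `e`-free core at level `5`, rank `18`, corank `14`**: the quart XQICT core with `s₃ ≤ 40` (cq3), `s₄ ≤ 611`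
(avgChain), `s₅ ≤ 5877` (avgChain5b); slack `308/1024`. -/
theorem c025_core_five_eighteen_q14 (M : Matroid α) [M.Finite]
    (hR : M.eRank = ((18 : ℕ) : ℕ∞)) (hn : M.E.ncard = 18 + 14)
    (hfree : ∀ e ∈ M.E, ∃ A ⊆ M.E \ {e}, e ∉ M.closure A ∧ e ∉ M.closure ((M.E \ {e}) \ A)) :
    RLS M 18 5 := by
  have hd : M.E.encard = M.eRank + ((14 : ℕ) : ℕ∞) := by
    rw [hR, ← M.ground_finite.cast_ncard_eq, hn]
    push_cast
    ring
  have hs3 := TriangleCap.core_ncard_triangles_le_cq3 M hfree hd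
  rw [show TriangleCap.cq3 14 = 40 by decide +kernel] at hs3
  have hs4 := S1.ncard_fourCircuits_le_avgChain 14 M hfree hd
  rw [show S1.avgChain 14 = 611 by decide +kernel] at hs4
  have hs5 := S1.ncard_fiveCircuits_le_avgChain5b 14 M hfree hd
  rw [show S1.avgChain5b 14 = 5877 by decide +kernel] at hs5
  exact c025_core_five_sharp_cell_xqictq5 M 18 14 (by norm_num) (by norm_num) hR hn hfree 40 611 5877 hs3 hs4 hs5
    ⟨308, by norm_num, S2.cellP18Q_14_poly, S2.cellP18Q_14_tail⟩

/-- **The `e`-free core at level `5`, rank `18`, every corank `6 ≤ d ≤ 29`**. -/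
theorem c025_core_five_eighteen_xx (M : Matroid α) [M.Finite] (d : ℕ)
    (hd6 : 6 ≤ d) (hd29 : d ≤ 29) (hR : M.eRank = ((18 : ℕ) : ℕ∞)) (hn : M.E.ncard = 18 + d)
    (hfree : ∀ e ∈ M.E, ∃ A ⊆ M.E \ {e}, e ∉ M.closure A ∧ e ∉ M.closure ((M.E \ {e}) \ A)) :
    RLS M 18 5 := by
  by_cases h6 : d = 6
  · subst h6; exact c025_core_five_eighteen_six M hR hn hfree
  by_cases h7 : d = 7
  · subst h7; exact c025_core_five_eighteen_seven M hR hn hfree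
  by_cases h8 : d = 8
  · subst h8; exact c025_core_five_eighteen_eight M hR hn hfree
  by_cases h9 : d = 9
  · subst h9; exact c025_core_five_eighteen_q9 M hR hn hfree
  by_cases h10 : d = 10
  · subst h10; exact c025_core_five_eighteen_ten M hR hn hfree
  by_cases h11 : d = 11
  · subst h11; exact c025_core_five_eighteen_q11 M hR hn hfree
  by_cases h12 : d = 12
  · subst h12; exact c025_core_five_eighteen_q12 M hR hn hfree
  by_cases h14 : d = 14
  · subst h14; exact c025_core_five_eighteen_q14 M hR hn hfree
  have hd : M.E.encard = M.eRank + d := by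
    rw [hR, ← M.ground_finite.cast_ncard_eq, hn]
    push_cast
    ring
  have hs3 := TriangleCap.core_ncard_triangles_le_cq3 M hfree hd
  have hs4 := S1.ncard_fourCircuits_le_avgChain d M hfree hd
  exact c025_core_five_sharp_cell_xqict M 18 d hd6 (by norm_num) hR hn hfree (TriangleCap.cq3 d) (S1.avgChain d) hs3 hs4
    (S2.cellsP18X d (by omega) hd29 h14)

/-- **THEOREM C₅, GIVEN LEVEL `4` FROM `P ≥ 18`**: level `4` for all `p ≥ P` implies level `5` for all `p ≥ P + 1`
(the `p = 18` row by `c025_core_five_eighteen_xx` / `c025_core_five_at_eighteen_big`, the `p = 19` row by the «20» kit, the rows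
`p ≥ 20` by `c025_five_of_four_cq_xx_from`). -/
theorem c025_five_of_four_cq_xix_from (P : ℕ) (hP : 18 ≤ P)
    (h4 : ∀ (M : Matroid α) [M.Finite] (p : ℕ), P ≤ p → RLS M p 4) :
    ∀ (M : Matroid α) [M.Finite] (p : ℕ), P + 1 ≤ p → RLS M p 5 := by
  rcases Nat.lt_or_ge P 19 with hP18 | hP19
  · have hP' : P = 18 := by omega
    subst hP'
    refine S2.rls_five_of_four_of_core 18 (by omega) h4 ?_
    intro M _ p hP' hR hbig hfree
    rcases Nat.lt_or_ge p 19 with h18 | h19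
    · have hp' : p = 18 := by omega
      subst hp'
      rcases Nat.lt_or_ge M.E.ncard (18 + 30) with h | h
      · exact c025_core_five_eighteen_xx M (M.E.ncard - 18) (by omega) (by omega) hR (by omega) hfree
      · exact c025_core_five_at_eighteen_big M (by omega) hfree
    rcases Nat.lt_or_ge p 20 with h19' | h20
    · have hp' : p = 19 := by omega
      subst hp'
      rcases Nat.lt_or_ge M.E.ncard (19 + 29) with h | h
      · exact c025_core_five_nineteen_xx M (M.E.ncard - 19) (by omega) (by omega) hR (by omega) hfree
      · exact c025_core_five_at_nineteen_big M (by omega) hfree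
    · exact c025_five_of_four_cq_xx_from 19 le_rfl (fun M _ p hp => h4 M p (by omega)) M p h20
  · exact c025_five_of_four_cq_xx_from P hP19 h4

/-- **THEOREM C₅ AT `19`**: every finite matroid satisfies C-025 at level `5` for every `p ≥ 19` (level `4` from S1's
`c025_four_seventeen`). -/
theorem c025_five_large_sharp19 (M : Matroid α) [M.Finite] (p : ℕ) (hp : 19 ≤ p) : RLS M p 5 :=
  c025_five_of_four_cq_xix_from 18 le_rfl (fun M _ p hp => S1.c025_four_seventeen M p (by omega)) M p hp

/-- The level-`5` statement at `p ≥ 19` in the vocabulary of `C025`. -/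
theorem c025_five_large_sharp19' (M : Matroid α) [M.Finite] (p : ℕ) (hp : 19 ≤ p) :
    phiK p 5 * ({A : Set α | A ⊆ M.E ∧ M.eRk A = (p : ℕ∞) ∧ M.eRk (M.E \ A) = (5 : ℕ∞)}.ncard : ℚ) ≤
      ({A : Set α | A ⊆ M.E ∧ (5 : ℕ∞) < M.eRk A ∧ M.eRk A < (p : ℕ∞)}.ncard : ℚ) :=
  c025_five_large_sharp19 M p hp

end ThmN

end PercRepro
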